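import Summits.CriticalPhenomena.PercolationContinuityZ3.Theses.PercThresholdOne
import Summits.CriticalPhenomena.PercolationContinuityZ3.Theorems.PercNearOneGluingNoHeavyLowerTailCSHTheoremOne
import Literature.Probability.Percolation.SupercriticalIsoperimetricProfileDischarge
import Literature.Probability.Percolation.AnchoredIsoperimetricProfileLowerBound
import HarnessLib

/-!
# `PercThresholdOne.SamePAnchoredIsoperimetry` (stmt-CriticalPhenomena-5260) — PROVED

Item `stmt-CriticalPhenomena-5260` of route `CriticalPhenomena/PercThresholdOne` (crux r4, "the
card's isoperimetric leg"): for every `p` with `θ(p) > 0`, `P_p`-a.s. on `{C(0) infinite}` there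
are `c > 0` and `N` with `c·|K| ≤ n·|∂°K|` for all `n ≥ N` and all valid `K` (`0 ∈ K`, `K`
open-connected to `0` inside `K`, `|K| ≤ n³`), `∂°K` = the OPEN lattice edges with exactly one
endpoint in `K` — i.e. `liminf_n n·φ̂_n(p) > 0`.

Proof. `θ(p) > 0` forces `p > p_c(ℤ³)`: `p < p_c` gives `θ(p) = 0`
(`theta_eq_zero_of_lt_criticalProb_holds`) and `p = p_c` gives `θ(p_c) = 0` by the tree theorem
`CSH.percolationContinuityZ3_holds` (p205010). For `p > p_c` the statement is the tree's
`ae_exists_mul_card_le_of_pete` (`AnchoredIsoperimetricProfileLowerBound.lean`: Pete's in-box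
isoperimetry at level `n³` plus `|∂°K| ≥ 1` for small `K`), whose hypothesis — the named fact
`Pete2008_cor13` (Pete 2008, Cor. 1.3: isoperimetric profile of the supercritical infinite cluster)
— is now DISCHARGED (`Pete2008_cor13_holds`, `SupercriticalIsoperimetricProfileDischarge.lean`,
this generation: Kesten–Zhang block surfaces of open-connected sets with few open exits, half-bad
Peierls counting, Borel–Cantelli).

builds on p205010 (kernel theorem, internal audit signed; external expert review pending) — USED
(`CSH.percolationContinuityZ3_holds`, only to exclude `p = p_c`). RSW3 lane, lead gen 33
(prover-prim-rsw3-lead-g33-0).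
References: G. Pete, Electron. Commun. Probab. 13 (2008), Cor. 1.3 [Pete2008]; R. Cerf, B. Dembin,
Electron. Commun. Probab. 25 (2020), Thm. 1.1 [CerfDembin2020]; G. Kozma, N. Nitzan (2024)
[KozmaNitzan2024].
-/

noncomputable section

namespace Summit.CriticalPhenomena.PercolationContinuityZ3.Theorems

namespace PercThresholdOneSamePAnchoredIsoperimetry

open MeasureTheory Literature.Probability.Percolation Literature.Probability.LatticeModels

/-- **`θ(p) > 0` on `ℤ³` forces `p > p_c(ℤ³)`** (below `p_c` by the definition of `p_c`, at `p_c`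
by `θ(p_c) = 0`, p205010). [cite: KozmaNitzan2024, Thm. 6 with Conj. 3 (p. 15)] -/
theorem criticalProb_lt_of_theta_pos (p : unitInterval) (hθ : 0 < theta (zdGraph 3) (0 : Site 3) p) :
    criticalProb (zdGraph 3) (0 : Site 3) < (p : ℝ) := by
  rcases lt_or_ge (criticalProb (zdGraph 3) (0 : Site 3)) (p : ℝ) with h | h
  · exact h
  exfalso
  rcases h.lt_or_eq with hlt | heq
  · exact hθ.ne' (theta_eq_zero_of_lt_criticalProb_holds (zdGraph 3) (0 : Site 3) p hlt)
  · have hp : p = criticalProbI 3 := Subtype.ext heq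
    rw [hp] at hθ
    exact hθ.ne' CSH.percolationContinuityZ3_holds

/-- **`PercThresholdOne.SamePAnchoredIsoperimetry` (stmt-CriticalPhenomena-5260), proved**:
`θ(p) > 0 ⇒` a.s. on `{C(0) infinite}`, `liminf_n n φ̂_n(p) > 0` in competitor form. From Pete 2008
Cor. 1.3 (discharged) via `ae_exists_mul_card_le_of_pete`, and `p > p_c` from `θ(p_c) = 0`.
[cite: Pete2008, Cor. 1.3] [cite: CerfDembin2020, Thm. 1.1 (consequence: liminf n φ̂_n > 0)] -/
theorem samePAnchoredIsoperimetry_proof :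
    Summit.CriticalPhenomena.PercolationContinuityZ3.Theses.PercThresholdOne.SamePAnchoredIsoperimetry := by
  unfold Summit.CriticalPhenomena.PercolationContinuityZ3.Theses.PercThresholdOne.SamePAnchoredIsoperimetry
  intro p hθ
  have hpc := criticalProb_lt_of_theta_pos p hθ
  have h := ae_exists_mul_card_le_of_pete Pete2008_cor13_holds (by norm_num : 2 ≤ 3) p hpc
  filter_upwards [h] with ω hω hinf
  obtain ⟨c, hc, N, hN⟩ := hω hinf
  refine ⟨c, hc, N, fun n hn K h0K hKconn hKcard => ?_⟩
  exact hN n hn K ⟨h0K, hKconn⟩ hKcard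

end PercThresholdOneSamePAnchoredIsoperimetry

end Summit.CriticalPhenomena.PercolationContinuityZ3.Theorems

end
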